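import Mathlib
import HarnessLib
import Summits.NavierStokesRegularity.NavierStokesRegularity.Theorems.TaylorModelRungThreeCertificateReadoutVSoundWinA

/-!
# Crux K1b-DR (stmt-NavierStokesRegularity-23954), line `taylor-model` — v3 WINDOWED read-outs SOUNDNESS, part B (ns-tm-g4 g6):
# the clauses (R6), (R10w), (R11w), (W4) of `ReadoutsVW` for the interpreted records, and the assembly **`readoutsVW_of_checks'`**

Window analogue of typer g32/g33's `…ReadoutVSoundB` / `readoutsV_of_checks'`:
* `readoutW_R6` — (R6) on the FAT in-step boxes (`toReadoutDataWin`'s `ylo/yhi` ARE part 5's `Y0/Y1`; proof = `readout_R6_gen`);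
* `readoutW_R10` — (R10w): for in-step kernels at `u` in the LEVEL-1 WINDOW, `A·(Vc + Cm·W) ∈ [Vlo, Vhi]` (= the windowed kernel box `VBw`);
* `readoutW_R11` — (R11w) on `Z¹`, given the ENTRY box of the polytope parametrisation;
* `readoutW_W4` — (W4): the windowed in-step boxes `Z⁰/Z¹` contain the in-step states for `u` in the window of their level;
* `readoutsVW_of_checks' : KitOK → checkReadoutsWin' = true → (R4 per sub-step) → (R0)…(R3) (composer's clauses) → (entry box) →
  ReadoutsVW (toCertDataVW …) (toBoxesW …) (toRadiiW …) (toReadoutDataWin … G ΛT) (toWinData …)`.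

HONEST FRAMING: kernel bookkeeping for the MODEL certificate №23954 (rung TL-M3); nothing here is a statement about the
Navier–Stokes equations.
-/

-- the sub-problem namespace repeats the summit name by design (D-0017)
set_option linter.dupNamespace false

namespace Summit.NavierStokesRegularity.NavierStokesRegularity.Theorems.TaylorModelCert

open scoped BigOperators
open Set
open Literature.Analysis.FluidPDE.TaoCascade Literature.Analysis.FluidPDE.TaoCascade.TaylorChain
open Summit.NavierStokesRegularity.NavierStokesRegularity.Theorems.TaylorModelReadout
open Summit.NavierStokesRegularity.NavierStokesRegularity.Theorems.TaylorModelV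

namespace CertTablesV

variable {TV : CertTablesV} {kitOf : ℕ → CoreKit} {wT : ℕ → Array Dyad} {sc : ScalarsV} {A : ReadoutAux QS2} {WV : WindowsV}

/-! ### (R6) on the fat in-step boxes -/

/-- **(R6)** of `ReadoutsVW` at stage `j` (the fat boxes of `toReadoutDataWin` are part 5's `Y0/Y1`). [folklore] -/
theorem readoutW_R6 (hk : KitOK TV kitOf) {G : ℕ → ℕ → ℕ → ℝ} {ΛT : ℕ → ℝ} {j : ℕ} :
    ∀ l : Fin 2, ∀ u ∈ Icc 0 ((TV.toCertDataVW kitOf wT sc).h j ((TV.toCertDataVW kitOf wT sc).S j - 1)), ∀ Ak : Ker,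
      InStepKer (TV.toCertDataVW kitOf wT sc) (TV.toBoxesW kitOf wT) j ((TV.toCertDataVW kitOf wT sc).S j - 1) u Ak →
      ∀ y, InBox (TV.toCertDataVW kitOf wT sc) ((TV.toBoxesW kitOf wT).hlo (hullLevel l) j ((TV.toCertDataVW kitOf wT sc).S j - 1))
          ((TV.toBoxesW kitOf wT).hhi (hullLevel l) j ((TV.toCertDataVW kitOf wT sc).S j - 1)) y →
      ∀ r : Fin 4 → ℤ → ℝ, AbsLeW (TV.toCertDataVW kitOf wT sc) r
          (fun i k => (TV.toBoxesW kitOf wT).J j ((TV.toCertDataVW kitOf wT sc).S j - 1) i k * u ^ ((TV.toCertDataVW kitOf wT sc).pdeg + 1)) →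
        InBox (TV.toCertDataVW kitOf wT sc) ((TV.toReadoutDataWin kitOf wT A WV G ΛT).ylo l j) ((TV.toReadoutDataWin kitOf wT A WV G ΛT).yhi l j)
          ((TV.toCertDataVW kitOf wT sc).TP j ((TV.toCertDataVW kitOf wT sc).S j - 1) u + r +
            kapp (TV.toCertDataVW kitOf wT sc) Ak (y - (TV.toCertDataVW kitOf wT sc).x j ((TV.toCertDataVW kitOf wT sc).S j - 1))) := by
  intro l u hu Ak hA y hy r hr
  rcases l with ⟨_ | _ | l2, hl⟩
  · exact readout_R6_gen hk (l := 0) rfl rfl hu hA hy hr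
  · exact readout_R6_gen hk (l := 1) rfl rfl hu hA hy hr
  · omega

/-! ### (R10w) the derivative kernel over the level-1 window -/

/-- **(R10w)** of `ReadoutsVW` at stage `j`. [folklore] -/
theorem readoutW_R10 (hk : KitOK TV kitOf) {G : ℕ → ℕ → ℕ → ℝ} {ΛT : ℕ → ℝ} {j : ℕ} (hok : (TV.roOutWin kitOf wT A WV j).ok = true) :
    ∀ u ∈ Icc ((TV.toWinData kitOf wT A WV).ulo 1 j) ((TV.toWinData kitOf wT A WV).uhi 1 j), ∀ Ak : Ker,
      InStepKer (TV.toCertDataVW kitOf wT sc) (TV.toBoxesW kitOf wT) j ((TV.toCertDataVW kitOf wT sc).S j - 1) u Ak →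
      ∀ W : Ker, KerMem (TV.toCertDataVW kitOf wT sc) W ((TV.toRadiiW kitOf wT).Zlo j ((TV.toCertDataVW kitOf wT sc).S j - 1))
          ((TV.toRadiiW kitOf wT).Zhi j ((TV.toCertDataVW kitOf wT sc).S j - 1)) →
        KerMem (TV.toCertDataVW kitOf wT sc)
          (kerOf fun v => kapp (TV.toCertDataVW kitOf wT sc) Ak ((TV.toRadiiW kitOf wT).Vc j ((TV.toCertDataVW kitOf wT sc).S j - 1) v +
            (TV.toCertDataVW kitOf wT sc).Cm j ((TV.toCertDataVW kitOf wT sc).S j - 1) (kapp (TV.toCertDataVW kitOf wT sc) W v)))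
          ((TV.toReadoutDataWin kitOf wT A WV G ΛT).Vlo j) ((TV.toReadoutDataWin kitOf wT A WV G ΛT).Vhi j) := by
  intro u hu Ak hA W hW
  rw [rw_ulo1, rw_uhi1] at hu
  set s := (TV.base.stage j).S - 1 with hs
  have hSs : (TV.toCertDataVW kitOf wT sc).S j - 1 = s := rfl
  rw [hSs] at hA hW ⊢
  have hu0 : 0 ≤ u := (TV.base.readoutStepWin_win (TV.roInWin kitOf wT A WV j) hok).1.trans hu.1
  have hwm : MemMat TV.base.n (TV.base.matOfKer W) (TV.nodeVW kitOf wT j s).Z := TV.base.memMat_matOfKer cd_Kb cd_Ka hW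
  have hM := TV.base.readoutStepWin_R10 (TV.roInWin kitOf wT A WV j) hk.coef (hk.box j) (size_hullBox 2 j s) hu0 hu.1 hu.2
    (fun i k h1 h2 => mem_ωinvB j i k h1 h2) (inStep_window hA) hwm
  intro i' k' hk1' hk2' i k hk1 hk2
  have hk' : -TV.base.Kb ≤ k' ∧ k' ≤ TV.base.Ka := ⟨hk1', hk2'⟩
  have hkk : -TV.base.Kb ≤ k ∧ k ≤ TV.base.Ka := ⟨hk1, hk2⟩
  have hr := TV.base.idx_lt_n i' hk'
  have hc := TV.base.idx_lt_n i hkk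
  have hm := hM _ hr _ hc
  -- the kernel entry is the product entry
  have e : kerOf (fun v => kapp (TV.toCertDataVW kitOf wT sc) Ak ((TV.toRadiiW kitOf wT).Vc j s v +
        (TV.toCertDataVW kitOf wT sc).Cm j s (kapp (TV.toCertDataVW kitOf wT sc) W v))) i' k' i k =
      ∑ t ∈ Finset.range TV.base.n, Ak (TV.base.wi (TV.base.idx i' k')) (TV.base.wk (TV.base.idx i' k')) (TV.base.wi t) (TV.base.wk t) *
        (dre (TV.nodeVW kitOf wT j s).Vc t (TV.base.idx i k) +
          ∑ t' ∈ Finset.range TV.base.n, dre (TV.nodeVW kitOf wT j s).B t t' * TV.base.matOfKer W t' (TV.base.idx i k)) := by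
    unfold kerOf
    beta_reduce
    rw [kapp_window Ak _ i' hk', TV.base.wi_idx i' hk', TV.base.wk_idx i' hk']
    refine Finset.sum_congr rfl fun t ht => ?_
    have ht' := Finset.mem_range.1 ht
    congr 1
    rw [rd_Vc, cd_Cm, TV.base.wv_add, TV.base.wv_linF _ _ ht', TV.base.wv_linF _ _ ht']
    congr 1
    · rw [Finset.sum_congr rfl (fun c hc' => by rw [wv_basisSt i hkk (Finset.mem_range.1 hc')])]
      simp only [mul_ite, mul_one, mul_zero]
      rw [Finset.sum_ite_eq' (Finset.range TV.base.n) (TV.base.idx i k), if_pos (Finset.mem_range.2 hc)]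
    · refine Finset.sum_congr rfl fun t' ht'' => ?_
      congr 1
      rw [wv_kapp W _ (Finset.mem_range.1 ht'')]
      unfold CertTables.matOfKer
      rw [Finset.sum_congr rfl (fun c hc' => by rw [wv_basisSt i hkk (Finset.mem_range.1 hc')])]
      simp only [mul_ite, mul_one, mul_zero]
      rw [Finset.sum_ite_eq' (Finset.range TV.base.n) (TV.base.idx i k), if_pos (Finset.mem_range.2 hc),
        TV.base.wi_idx i hkk, TV.base.wk_idx i hkk]
  rw [e, row_Vlo, row_Vhi]
  exact hm

/-! ### (R11w) landing derivative on the level-1 window box -/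

/-- **(R11w)** of `ReadoutsVW` at stage `j`, given the ENTRY box of the polytope parametrisation. [folklore] -/
theorem readoutW_R11 (hk : KitOK TV kitOf) (hA : TV.base.checkReadoutAux A = true) {G : ℕ → ℕ → ℕ → ℝ} {ΛT : ℕ → ℝ} {j : ℕ}
    (hok : (TV.roOutWin kitOf wT A WV j).ok = true)
    (hentry : ∀ q ζ : Fin 4 → ℤ → ℝ, InPoly (TV.toCertDataVW kitOf wT sc) j q →
      (∀ i k, -(TV.toCertDataVW kitOf wT sc).Kb ≤ k → k ≤ (TV.toCertDataVW kitOf wT sc).Ka →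
        q i k = ((TV.toCertDataVW kitOf wT sc).x j 0 + (TV.toRadiiW kitOf wT).Dsc j ζ) i k) →
      ∀ c < TV.base.n, |TV.base.wv ζ c| ≤ (dget (TV.stageV j).rB c).toReal) :
    ∀ y, InBox (TV.toCertDataVW kitOf wT sc) ((TV.toWinData kitOf wT A WV).zlo 1 j) ((TV.toWinData kitOf wT A WV).zhi 1 j) y →
      (TV.toCertDataVW kitOf wT sc).σf j y = (TV.toCertDataVW kitOf wT sc).lev j →
      ∀ V : Ker, KerMem (TV.toCertDataVW kitOf wT sc) V ((TV.toReadoutDataWin kitOf wT A WV G ΛT).Vlo j) ((TV.toReadoutDataWin kitOf wT A WV G ΛT).Vhi j) →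
      ∀ q ζ : Fin 4 → ℤ → ℝ, InPoly (TV.toCertDataVW kitOf wT sc) j q →
        (∀ i k, -(TV.toCertDataVW kitOf wT sc).Kb ≤ k → k ≤ (TV.toCertDataVW kitOf wT sc).Ka →
          q i k = ((TV.toCertDataVW kitOf wT sc).x j 0 + (TV.toRadiiW kitOf wT).Dsc j ζ) i k) →
      ∀ v, TailOK (TV.toCertDataVW kitOf wT sc) v → ∀ l,
        |(TV.toCertDataVW kitOf wT sc).ℓ ((TV.toCertDataVW kitOf wT sc).nx j) l
          ((TV.toCertDataVW kitOf wT sc).landD j y v (secCorr (TV.toCertDataVW kitOf wT sc) j y (kapp (TV.toCertDataVW kitOf wT sc) V ζ)))|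
          ≤ (TV.toCertDataVW kitOf wT sc).β j l := by
  intro y hy _ V hV q ζ hq hwin v hv l
  rw [rw_zlo1, rw_zhi1] at hy
  rw [row_Vlo, row_Vhi] at hV
  rw [cd_nx, cd_ell, cd_landD, cd_secCorr, cd_beta]
  by_cases hl : l < TV.nF j
  · rw [TV.base.covR_apply]
    exact TV.base.readoutStepWin_R11 (TV.roInWin kitOf wT A WV j) hk.coef (hk.box j) (hk.mt j) hok (mem_faceB _ _) (mem_partnerG j _)
      (mem_partnerR j _) (mem_listB _ _) (IntervalD.mem_ofQS2 _ _) (tail_le (kitOf := kitOf) (wT := wT) (sc := sc) hA hv)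
      (memVec_of_inBox_loR hy) (mem_covB _) (TV.base.memMat_matOfKer cd_Kb cd_Ka hV) (hentry q ζ hq hwin)
      (fun l' _ => partner_face hq hwin l') (fun b hb => wv_kapp V ζ hb) hl
  · rw [not_lt] at hl
    obtain ⟨h1, h2, _, _, _⟩ := lengths_le_nF (TV := TV) j
    rw [List.getD_eq_default _ _ (le_trans h1 hl), TV.base.covR_nil, vget_of_le _ (le_trans h2 hl)]
    simp

/-! ### (W4) the windowed in-step boxes -/

/-- **(W4)** of `ReadoutsVW` at stage `j`: for `u` in the window of level `l`, the in-step states of hull-`l` starts lie in `Z^l`.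
[folklore] -/
theorem readoutW_W4 (hk : KitOK TV kitOf) {j : ℕ} (hok : (TV.roOutWin kitOf wT A WV j).ok = true) :
    ∀ l : Fin 2, ∀ u ∈ Icc ((TV.toWinData kitOf wT A WV).ulo l j) ((TV.toWinData kitOf wT A WV).uhi l j), ∀ Ak : Ker,
      InStepKer (TV.toCertDataVW kitOf wT sc) (TV.toBoxesW kitOf wT) j ((TV.toCertDataVW kitOf wT sc).S j - 1) u Ak →
      ∀ y, InBox (TV.toCertDataVW kitOf wT sc) ((TV.toBoxesW kitOf wT).hlo (hullLevel l) j ((TV.toCertDataVW kitOf wT sc).S j - 1))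
          ((TV.toBoxesW kitOf wT).hhi (hullLevel l) j ((TV.toCertDataVW kitOf wT sc).S j - 1)) y →
      ∀ r : Fin 4 → ℤ → ℝ, AbsLeW (TV.toCertDataVW kitOf wT sc) r
          (fun i k => (TV.toBoxesW kitOf wT).J j ((TV.toCertDataVW kitOf wT sc).S j - 1) i k * u ^ ((TV.toCertDataVW kitOf wT sc).pdeg + 1)) →
        InBox (TV.toCertDataVW kitOf wT sc) ((TV.toWinData kitOf wT A WV).zlo l j) ((TV.toWinData kitOf wT A WV).zhi l j)
          ((TV.toCertDataVW kitOf wT sc).TP j ((TV.toCertDataVW kitOf wT sc).S j - 1) u + r +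
            kapp (TV.toCertDataVW kitOf wT sc) Ak (y - (TV.toCertDataVW kitOf wT sc).x j ((TV.toCertDataVW kitOf wT sc).S j - 1))) := by
  have hw := TV.base.readoutStepWin_win (TV.roInWin kitOf wT A WV j) hok
  intro l u hu Ak hA y hy r hr
  rcases l with ⟨_ | _ | l2, hl⟩
  · -- level 0: `Z0` over `[u0lo, u0hi]`
    exact inBox_loR_of_memVec (readoutW_Zl_gen (sc := sc) hk hok (l := 0) rfl (U := ⟨(winAt WV j).u0lo, (winAt WV j).u0hi⟩)
      (uR := (winAt WV j).u0hi) ⟨hu.1, hu.2⟩ (hw.2.1.trans hu.1) (hu.2.trans hw.2.2.2.1) hu.2 hA hy hr)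
  · -- level 1: `Z1` over `[u1lo, u1hi]`
    exact inBox_loR_of_memVec (readoutW_Zl_gen (sc := sc) hk hok (l := 1) rfl (U := ⟨(winAt WV j).u1lo, (winAt WV j).u1hi⟩)
      (uR := (winAt WV j).u1hi) ⟨hu.1, hu.2⟩ hu.1 hu.2 hu.2 hA hy hr)
  · omega

/-! ### Assembly -/

/-- **The WINDOWED read-outs of the interpreted v3 certificate from the windowed read-out checks**: as typer g33's
`readoutsV_of_checks'`, with `checkReadoutsWin' kitOf wT A WV = true` (windowed read-out steps, checkpoint form), the per-sub-step
(R4) Booleans `hR4` (from the chunk runs), the composer's (R0)–(R3), and the ENTRY box of the polytope parametrisation; the records are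
`toReadoutDataWin` (fat `Y` boxes + windowed kernel box) and `toWinData` (windows + windowed `Z` boxes). [folklore] -/
theorem readoutsVW_of_checks' (hk : KitOK TV kitOf) (hchk' : TV.checkReadoutsWin' kitOf wT A WV = true)
    (hR4 : ∀ j, j ≤ TV.base.N₀ → ∀ s, s < (TV.base.stage j).S →
      TV.base.testR4 TV.MB (TV.AB j) (TV.coreVW kitOf wT j s) = true)
    {G : ℕ → ℕ → ℕ → ℝ} {ΛT : ℕ → ℝ}
    (hR0 : ∀ j, j ≤ TV.base.N₀ →
      (TV.toCertDataVW kitOf wT sc).Tn j ((TV.toCertDataVW kitOf wT sc).S j) ≤ (TV.toCertDataVW kitOf wT sc).τs ∧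
      InPoly (TV.toCertDataVW kitOf wT sc) j ((TV.toCertDataVW kitOf wT sc).x j 0) ∧ 0 < (TV.toCertDataVW kitOf wT sc).γ j ∧
      0 ≤ (TV.toReadoutDataWin kitOf wT A WV G ΛT).ΛT j ∧
      (∀ y : Fin 4 → ℤ → ℝ, (TV.toCertDataVW kitOf wT sc).σf j y = (TV.toCertDataVW kitOf wT sc).σf j (trunc (TV.toCertDataVW kitOf wT sc) y)))
    (hR1 : ∀ j, j ≤ TV.base.N₀ → ∀ s', s' ≤ (TV.toCertDataVW kitOf wT sc).S j → ∀ y d : Fin 4 → ℤ → ℝ,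
      InBox (TV.toCertDataVW kitOf wT sc) ((TV.toBoxesW kitOf wT).hlo 1 j s') ((TV.toBoxesW kitOf wT).hhi 1 j s') y →
      (TV.toCertDataVW kitOf wT sc).InBall j d ((TV.toReadoutDataWin kitOf wT A WV G ΛT).ΛT j * (TV.toCertDataVW kitOf wT sc).κ j) →
      InBox (TV.toCertDataVW kitOf wT sc) ((TV.toBoxesW kitOf wT).hlo 2 j s') ((TV.toBoxesW kitOf wT).hhi 2 j s') (y + d))
    (hR2 : ∀ j, j ≤ TV.base.N₀ → ∀ s₀ s₁, s₀ ≤ s₁ → s₁ ≤ (TV.toCertDataVW kitOf wT sc).S j → ∀ Ac : ℕ → Ker,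
      (∀ s', s₀ ≤ s' → s' < s₁ → KerMem (TV.toCertDataVW kitOf wT sc) (Ac s') ((TV.toBoxesW kitOf wT).Mlo j s') ((TV.toBoxesW kitOf wT).Mhi j s')) →
      ∀ (v : Fin 4 → ℤ → ℝ) (r : ℝ), 0 ≤ r → (TV.toCertDataVW kitOf wT sc).InBall j v r →
        (TV.toCertDataVW kitOf wT sc).InBall j (kiter (TV.toCertDataVW kitOf wT sc) Ac s₀ (s₁ - s₀) v) ((TV.toReadoutDataWin kitOf wT A WV G ΛT).G j s₀ s₁ * r))
    (hR3a : ∀ j, j ≤ TV.base.N₀ → ∀ a b, a < (TV.toCertDataVW kitOf wT sc).S j → a + 1 ≤ b → b ≤ (TV.toCertDataVW kitOf wT sc).S j →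
      (TV.toCertDataVW kitOf wT sc).L1 j a * (TV.toReadoutDataWin kitOf wT A WV G ΛT).G j (a + 1) b ≤ (TV.toReadoutDataWin kitOf wT A WV G ΛT).ΛT j ∧
      (b < (TV.toCertDataVW kitOf wT sc).S j →
        (TV.toCertDataVW kitOf wT sc).L1 j a * (TV.toReadoutDataWin kitOf wT A WV G ΛT).G j (a + 1) b * (TV.toCertDataVW kitOf wT sc).L1 j b ≤
          (TV.toCertDataVW kitOf wT sc).Λ j))
    (hR3b : ∀ j, j ≤ TV.base.N₀ → ∀ a, a < (TV.toCertDataVW kitOf wT sc).S j → (TV.toCertDataVW kitOf wT sc).L1 j a ≤ (TV.toCertDataVW kitOf wT sc).Λ j)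
    (hentry : ∀ j, j ≤ TV.base.N₀ → ∀ q ζ : Fin 4 → ℤ → ℝ, InPoly (TV.toCertDataVW kitOf wT sc) j q →
      (∀ i k, -(TV.toCertDataVW kitOf wT sc).Kb ≤ k → k ≤ (TV.toCertDataVW kitOf wT sc).Ka →
        q i k = ((TV.toCertDataVW kitOf wT sc).x j 0 + (TV.toRadiiW kitOf wT).Dsc j ζ) i k) →
      ∀ c < TV.base.n, |TV.base.wv ζ c| ≤ (dget (TV.stageV j).rB c).toReal) :
    ReadoutsVW (TV.toCertDataVW kitOf wT sc) (TV.toBoxesW kitOf wT) (TV.toRadiiW kitOf wT) (TV.toReadoutDataWin kitOf wT A WV G ΛT)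
      (TV.toWinData kitOf wT A WV) := by
  intro j hj
  have hjN : j ≤ TV.base.N₀ := hj
  unfold checkReadoutsWin' at hchk'
  simp only [Bool.and_eq_true] at hchk'
  obtain ⟨hAux, hall⟩ := hchk'
  have hok : (TV.roOutWin kitOf wT A WV j).ok = true := by
    rw [← checkReadoutStageWin'_eq]
    exact (allN_eq_true.1 hall) j (Nat.lt_succ_of_le hjN)
  have h4 : allN (TV.base.stage j).S (fun s => TV.base.testR4 TV.MB (TV.AB j) (TV.coreVW kitOf wT j s)) = true :=
    allN_eq_true.2 fun s hs => hR4 j hjN s hs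
  obtain ⟨h0a, h0b, h0c, h0d, h0e⟩ := hR0 j hjN
  exact ⟨h0a, h0b, h0c, h0d, h0e, hR1 j hjN, hR2 j hjN, hR3a j hjN, hR3b j hjN, readout_R4 h4, (readoutW_R5 hok).1, (readoutW_R5 hok).2,
    readoutW_R6 hk, readoutW_R7 hk hok, readoutW_R8 hAux hok, readoutW_R9 hAux hok, readoutW_R10 hk hok,
    readoutW_R11 hk hAux hok (hentry j hjN), readoutW_W1 hok, readoutW_W2 hk hok, readoutW_W3 hk hok, readoutW_W4 hk hok⟩

end CertTablesV

end Summit.NavierStokesRegularity.NavierStokesRegularity.Theorems.TaylorModelCert
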